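import Summits.QuantumAdvantage.QuantumAdvantage.Theses.CubicForrelation
import Summits.QuantumAdvantage.QuantumAdvantage.Theorems.ExactPairsMaioranaMcFarland.Negative.DillonCertificate
import Literature.Computability.QuantumComplexity.ForrelationDerivativeTables

/-!
# Line `bent-pencil-descent` — skeleton for the crux `CubicForrelation.ExactPairsMaioranaMcFarland`
(crux item stmt-QuantumAdvantage-2205, rank 5, route `route-QuantumAdvantage-CubicForrelation`)

Crux (FIXED, by name): for every `m` and every pair `f g : 𝔽₂^{m+m} → 𝔽₂` of CUBIC Boolean functions with
`forrelation f g = 1` (i.e. `g` bent with dual exactly `f`, BOTH cubic), `g` is in the completed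
Maiorana–McFarland class — literally `MMConclusionAt m g` (`Negative/DillonCertificate.lean`,
`exactPairsMaioranaMcFarland_iff : ExactPairsMaioranaMcFarland ↔ ∀ m f g, … → MMConclusionAt m g`, `Iff.rfl`).

Idea (crux idea card `bent-pencil-descent`, ideator 1; triage r1-1/2/3: pass, merge ≈ `bent4-descent-gluing`):
INDUCTION ON `m` THROUGH BENT PENCILS. Because the dual `f = g̃` is cubic, every derivative `D_a f` is a balanced
QUADRATIC function, so it has a partner `b` with `D_a D_b f ≡ 1` (Carlet–Villa 2025 Prop. 1 / Carlet 2020 Prop. 55);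
by Canteaut–Charpin 2003 ("Decomposing bent functions") `D_a D_b g̃ ≡ 1` is exactly the condition that the four
restrictions of `g` to the cosets of the codimension-2 space `⟨a,b⟩^⊥` are bent (a *bent pencil* / bent
4-decomposition), and the duals of the pieces are the restrictions of `f ⊕ (a·x₀ ⊕ D_a f)(b·x₀ ⊕ D_b f)` (Carlet's
piece-dual formula). Hence the pieces are again CUBIC/CUBIC exactly-forrelated pairs in `2m` variables precisely
when the pencil is GOOD: `deg (D_a f · D_b f) ≤ 3` (the quartic part of the product is the wedge `ω_a ∧ ω_b` of the
symplectic forms of the two quadratic derivatives — triage r1-2 S2 / r1-3 L2, verified on 1500 pencils + 600 moves).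
Descend through good pencils to `8` variables, where every cubic bent function is Maiorana–McFarland
(Rothaus/Dillon `n ≤ 6`, Hou 1998 / Braeken 2006 `n = 8`; PP20 §4.2), and climb back with the ASCENT lemma: a cubic
bent `g` with CUBIC dual whose four pencil pieces are MM# is MM# (the refuters' `0 / 5.8·10⁵` statistic on cubic-dual
bent 4-concatenations of MM# cubics, REVIEW3/REVIEW4 on the item, as the inductive step).

THE LINE (5 registered stubs, glued by `ExactPairsMaioranaMcFarland_of`, an induction on `m`):
* `stub_dualPair` (S1, bridge, known: Cauchy–Schwarz/Parseval; DuttaMaitraMukherjee2024 §3) —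
  `forrelation f g = 1 ↔ ∀ x, W_g(x) = 2^m (−1)^{f x}` (`g` bent with dual exactly `f`); no degree hypothesis.
  This is where the hypothesis `forrelation f g = 1` enters (Disproof `_false_without_forrelation`).
* `stub_smallCases` (S2, base `m ≤ 4`, known classification: every CUBIC bent function in `≤ 8` variables is in the
  completed MM class; sizes L — a finite but large certified computation / classification import).
* `stub_goodPencil` (S3, OPEN, "Inherit-∃" of the merged cards): for `m ≥ 4`, every cubic/cubic dual pair on
  `2(m+1) ≥ 10` variables has a GOOD bent pencil `(a,b)`: `D_aD_b f ≡ 1` and `deg(D_a f · D_b f) ≤ 3`. Pencils always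
  exist (partner lemma); goodness is universal at `n = 10` and existential (fractions 0.18–1.0, 30/30 instances incl.
  the Ker T = 0 Gold pair) at `n = 12, 14` in all triage data; universally it is FALSE at `n = 12` (609/1740).
* `stub_pencilDecomposition` (S4, known theorem: Canteaut–Charpin 2003 Thm. + Carlet's piece-dual formula + degree
  bookkeeping; all `m`): along a good pencil, each coset `x₀ + ⟨a,b⟩^⊥` carries an affine parametrisation
  `φ : 𝔽₂^{2m} → 𝔽₂^{2m+2}` under which `g ∘ φ` is a cubic bent function with a CUBIC dual `f'` (a cubic/cubic dual
  pair one level down).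
* `stub_pencilAscent` (S5, OPEN, HARDEST — at `n = 10` it is the whole `m = 5` case of the crux): for `m ≥ 4`, a
  cubic bent `g` on `2(m+1)` variables with CUBIC dual `f`, a good pencil `(a,b)` of `f`, and all four pencil pieces
  in MM# (dimension `m`), is itself in MM# (dimension `m+1`). Must use `f` cubic: PPKZ arXiv:2310.10162 Ex. 4 is a
  cubic bent 4-concatenation of 8-variable MM# cubics OUTSIDE MM# — with QUARTIC dual (REVIEW3); and Disproof
  `_false_without_fCubic` (`h^10_4`).
* `ExactPairsMaioranaMcFarland_of : ExactPairsMaioranaMcFarland` — kernel-checked composition (no `sorry` of its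
  own): induction on `m`; `m ≤ 4` by S1+S2; step `m+1 ≥ 5` by S1 → S3 → S4 (+ induction hypothesis on the four
  pieces, converted back through S1) → S5.

Disproof.lean (cdisprove cycle 1) honoured: `_false_without_forrelation` — exact duality enters at S1 and is carried
as the Walsh identity by S3/S4/S5; `_false_without_fCubic` — `f` cubic is a hypothesis of S3 (the pencil lives on
the dual: `D_a f` quadratic), S4 (cubic piece duals) and S5 (the ascent; false without it by PPKZ Ex. 4 / `h^10_4`);
`_false_without_gCubic` — `g` cubic is a hypothesis of S2 (base), S3, S4, S5. No stub is an instance of the landed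
`Theorems/ExactPairsMaioranaMcFarland/Negative/DillonCertificate.lean` (imported: it supplies `MMConclusionAt`,
`exactPairsMaioranaMcFarland_iff`, and the Dillon count certificate used only to REFUTE MM#-membership of explicit
10-variable functions — none of S2–S5 asserts MM# for `h^10_4`, `f4` or any quartic-dual function).

Vocabulary (all existing declarations): `forrelation`, `signOf`, `twist` (Forrelation.lean), `DerivativeWalsh.W`
(ForrelationDerivativeTables.lean: `W F y = ∑ x, F x * twist x y`, so `W (signOf ∘ g) x = W_g(x)`), `bx`
(pointwise xor) and `MMConclusionAt` (Negative/DillonCertificate.lean); "cubic" is the crux's own inline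
`∃ p : MvPolynomial …, p.totalDegree ≤ 3 ∧ …`; derivatives are written out: `D_a f x = f x ^^ f (bx x a)`.
-/

namespace Summit.QuantumAdvantage.QuantumAdvantage.Cruxes.ExactPairsMaioranaMcFarland.BentPencilDescent

open Literature.Computability.QuantumComplexity
open Summit.QuantumAdvantage.QuantumAdvantage.Theorems.ExactPairsMaioranaMcFarland.Negative
  (MMConclusionAt bx exactPairsMaioranaMcFarland_iff)

set_option linter.unusedVariables false
set_option linter.dupNamespace false

/-! ## S1 — the bridge: `Φ(f,g) = 1` iff `g` is bent with dual exactly `f` -/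

/-- **S1 `stub_dualPair`** (known; Cauchy–Schwarz + Parseval, DuttaMaitraMukherjee2024 §3 Lemma; tree:
`DerivativeWalsh.fsum_eq_sum_mul_W`, `sum_sum_dwt_sq_of_sq`). For ALL `f g` on `m+m` bits:
`forrelation f g = 1 ↔ ∀ x, W_g(x) = 2^m · (−1)^{f(x)}`, where `W_g(x) = ∑_y (−1)^{g(y) ⊕ x·y}`.
(`→`: `∑_x (−1)^{f x} W_g(x) = 2^{3m}` is the equality case of `|∑| ≤ √(4^m) · √(∑ W_g²) = 2^{3m}`;
`←`: direct.) Size: M. -/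
theorem stub_dualPair : ∀ (m : ℕ) (f g : (Fin (m + m) → Bool) → Bool),
    forrelation f g = 1 ↔
      ∀ x : Fin (m + m) → Bool, DerivativeWalsh.W (fun y => signOf (g y)) x = 2 ^ m * signOf (f x) := by
  sorry

/-! ## S2 — base of the induction: cubic bent functions in at most 8 variables are Maiorana–McFarland -/

/-- **S2 `stub_smallCases`** (known classification): for `m ≤ 4`, every CUBIC bent function `g` on `m+m ≤ 8` bits
(`|W_g(x)| = 2^m` for all `x`) satisfies the crux's conclusion `MMConclusionAt m g` (completed Maiorana–McFarland
normal form). `m ≤ 2`: bent ⇒ quadratic/affine-free part of rank `2m` (Dickson) ⇒ MM; `m = 3`: all bent functions in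
6 variables are MM (Rothaus 1976); `m = 4`: all CUBIC bent functions in 8 variables are in the completed MM class
(Hou 1998 "Cubic bent functions"; Braeken 2006 thesis; quoted in PolujanPott2020 §4.2). `m = 0` is the degenerate
one-point case (holds with `h := g ∘ e`). Size: L (finite classification; certified computation or a vendored
classification lemma re-proved against `MMConclusionAt`). -/
theorem stub_smallCases : ∀ (m : ℕ), m ≤ 4 → ∀ g : (Fin (m + m) → Bool) → Bool,
    (∃ p : MvPolynomial (Fin (m + m)) (ZMod 2), p.totalDegree ≤ 3 ∧
      ∀ x, g x = decide (MvPolynomial.eval (fun j => if x j then (1 : ZMod 2) else 0) p = 1)) →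
    (∀ x : Fin (m + m) → Bool,
      DerivativeWalsh.W (fun y => signOf (g y)) x = 2 ^ m ∨
        DerivativeWalsh.W (fun y => signOf (g y)) x = -(2 ^ m)) →
    MMConclusionAt m g := by
  sorry

/-! ## S3 — existence of a GOOD bent pencil of the (cubic) dual -/

/-- **S3 `stub_goodPencil`** (OPEN — the existential "Inherit" lemma of the merged cards `bent-pencil-descent` /
`bent4-descent-gluing`). Let `m ≥ 4` and let `(f, g)` be a cubic/cubic dual pair on `2(m+1) ≥ 10` bits
(`W_g = 2^{m+1} (−1)^f`). Then there are directions `a, b` with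
(i) `D_a D_b f ≡ 1` — a bent pencil: by Canteaut–Charpin the four restrictions of `g` to the cosets of `⟨a,b⟩^⊥`
are bent (this forces `a, b ≠ 0`, `a ≠ b`); such `b` exists for EVERY `a ≠ 0` because `D_a f` is a balanced
quadratic function (Carlet 2020 Prop. 55; Carlet–Villa 2025 Prop. 1, "cubic-like bent"); and
(ii) GOODNESS `deg (D_a f · D_b f) ≤ 3` — the quartic part `ω_a ∧ ω_b` of the product of the two quadratic
derivatives vanishes, equivalently (S4) the four pieces have CUBIC duals.
Why plausibly true: at `n = 10` every pencil of every cubic/cubic pair tested is good (4864/4864, triage r1-1 F2;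
1500/1500 wedge checks r1-2); at `n = 12, 14` good pencils are 18–100 % of all pencils in 30/30 instances
(r1-2 M4, r1-3), including the rigid Gold pair `Tr(x₁y³)+Tr(x₂z³)` with `Ker T = 0` (56/12992, r1-1 F4).
Why it might fail: a cubic/cubic pair at `n ≥ 12` all of whose `> (2ⁿ−1)/3` pencils have `ω_a ∧ ω_b ≠ 0`
(universal goodness IS false at `n = 12`: 609/1740). Size: M–L. -/
theorem stub_goodPencil : ∀ (m : ℕ), 4 ≤ m → ∀ f g : (Fin ((m + 1) + (m + 1)) → Bool) → Bool,
    (∃ p : MvPolynomial (Fin ((m + 1) + (m + 1))) (ZMod 2), p.totalDegree ≤ 3 ∧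
      ∀ x, f x = decide (MvPolynomial.eval (fun j => if x j then (1 : ZMod 2) else 0) p = 1)) →
    (∃ p : MvPolynomial (Fin ((m + 1) + (m + 1))) (ZMod 2), p.totalDegree ≤ 3 ∧
      ∀ x, g x = decide (MvPolynomial.eval (fun j => if x j then (1 : ZMod 2) else 0) p = 1)) →
    (∀ x : Fin ((m + 1) + (m + 1)) → Bool,
      DerivativeWalsh.W (fun y => signOf (g y)) x = 2 ^ (m + 1) * signOf (f x)) →
    ∃ a b : Fin ((m + 1) + (m + 1)) → Bool,
      (∀ x, (f x ^^ f (bx x a) ^^ f (bx x b) ^^ f (bx (bx x a) b)) = true) ∧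
      (∃ p : MvPolynomial (Fin ((m + 1) + (m + 1))) (ZMod 2), p.totalDegree ≤ 3 ∧
        ∀ x, ((f x ^^ f (bx x a)) && (f x ^^ f (bx x b))) =
          decide (MvPolynomial.eval (fun j => if x j then (1 : ZMod 2) else 0) p = 1)) := by
  sorry

/-! ## S4 — the Canteaut–Charpin decomposition along a good pencil, with cubic piece duals -/

/-- **S4 `stub_pencilDecomposition`** (known theorem, all `m`: Canteaut–Charpin 2003 "Decomposing bent functions"
+ Carlet's piece-dual formula + degree bookkeeping). Let `(f, g)` be a cubic/cubic dual pair on `2(m+1)` bits and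
`(a, b)` a GOOD bent pencil of `f` (`D_aD_b f ≡ 1`, `deg(D_a f · D_b f) ≤ 3`). Then for every `x₀` the coset
`x₀ + ⟨a,b⟩^⊥ = {x : a·x = a·x₀, b·x = b·x₀}` (of dimension `2m`, since `D_aD_b f ≡ 1` forces `a, b` linearly
independent) has an affine injective parametrisation `φ : 𝔽₂^{m+m} → 𝔽₂^{(m+1)+(m+1)}` such that `g ∘ φ` is
cubic and bent with a CUBIC dual `f'`: `W_{g∘φ} = 2^m (−1)^{f'}`. Proof sketch (Poisson summation over the coset):
`∑_{x ∈ x₀+V} (−1)^{g x ⊕ u·x} = 2^{m−1} ∑_{w ∈ {0,a,b,a+b}} (−1)^{w·x₀ ⊕ f(u+w)} = ±2^m` iff `D_aD_b f(u) = 1`, with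
sign `(−1)^{f(u) ⊕ (a·x₀ ⊕ D_a f u)(b·x₀ ⊕ D_b f u)}`; pull back along `φ` (characters compose with a linear
section), so `f' = (f ⊕ (a·x₀ ⊕ D_a f)(b·x₀ ⊕ D_b f)) ∘ R ⊕ ℓ` has degree `≤ 3` exactly because the pencil is
good; `g ∘ φ` is cubic as a cubic composed with an affine map. Size: M–L. -/
theorem stub_pencilDecomposition : ∀ (m : ℕ) (f g : (Fin ((m + 1) + (m + 1)) → Bool) → Bool),
    (∃ p : MvPolynomial (Fin ((m + 1) + (m + 1))) (ZMod 2), p.totalDegree ≤ 3 ∧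
      ∀ x, f x = decide (MvPolynomial.eval (fun j => if x j then (1 : ZMod 2) else 0) p = 1)) →
    (∃ p : MvPolynomial (Fin ((m + 1) + (m + 1))) (ZMod 2), p.totalDegree ≤ 3 ∧
      ∀ x, g x = decide (MvPolynomial.eval (fun j => if x j then (1 : ZMod 2) else 0) p = 1)) →
    (∀ x : Fin ((m + 1) + (m + 1)) → Bool,
      DerivativeWalsh.W (fun y => signOf (g y)) x = 2 ^ (m + 1) * signOf (f x)) →
    ∀ a b : Fin ((m + 1) + (m + 1)) → Bool,
    (∀ x, (f x ^^ f (bx x a) ^^ f (bx x b) ^^ f (bx (bx x a) b)) = true) →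
    (∃ p : MvPolynomial (Fin ((m + 1) + (m + 1))) (ZMod 2), p.totalDegree ≤ 3 ∧
      ∀ x, ((f x ^^ f (bx x a)) && (f x ^^ f (bx x b))) =
        decide (MvPolynomial.eval (fun j => if x j then (1 : ZMod 2) else 0) p = 1)) →
    ∃ L : (Fin (m + m) → Bool) → (Fin ((m + 1) + (m + 1)) → Bool),
      (∃ M : Matrix (Fin ((m + 1) + (m + 1))) (Fin (m + m)) (ZMod 2),
        ∀ y i, (if L y i then (1 : ZMod 2) else 0) = M.mulVec (fun j => if y j then (1 : ZMod 2) else 0) i) ∧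
      Function.Injective L ∧
      (∀ y, (∑ i, (if a i then (1 : ZMod 2) else 0) * (if L y i then (1 : ZMod 2) else 0)) = 0 ∧
        (∑ i, (if b i then (1 : ZMod 2) else 0) * (if L y i then (1 : ZMod 2) else 0)) = 0) ∧
      ∀ x₀ : Fin ((m + 1) + (m + 1)) → Bool,
        (∃ p : MvPolynomial (Fin (m + m)) (ZMod 2), p.totalDegree ≤ 3 ∧
          ∀ y, g (bx x₀ (L y)) = decide (MvPolynomial.eval (fun j => if y j then (1 : ZMod 2) else 0) p = 1)) ∧
        ∃ f' : (Fin (m + m) → Bool) → Bool,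
          (∃ p : MvPolynomial (Fin (m + m)) (ZMod 2), p.totalDegree ≤ 3 ∧
            ∀ y, f' y = decide (MvPolynomial.eval (fun j => if y j then (1 : ZMod 2) else 0) p = 1)) ∧
          ∀ u : Fin (m + m) → Bool,
            DerivativeWalsh.W (fun y => signOf (g (bx x₀ (L y)))) u = 2 ^ m * signOf (f' u) := by
  sorry

/-! ## S5 — the ASCENT: gluing four Maiorana–McFarland pencil pieces under a cubic dual (HARDEST) -/

/-- **S5 `stub_pencilAscent`** (OPEN, HARDEST; the load-bearing lemma `PencilAscent` of the card). Let `m ≥ 4`,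
`(f, g)` a cubic/cubic dual pair on `2(m+1) ≥ 10` bits, `(a, b)` a good bent pencil of `f`, and suppose that on
every coset `x₀ + ⟨a,b⟩^⊥` the piece `g ∘ φ` (for some affine injective parametrisation `φ` of that coset) satisfies
the Maiorana–McFarland conclusion in dimension `m`. Then `g` satisfies it in dimension `m + 1`.
Why plausibly true: among ≈ 5.8·10⁵ bent 4-concatenations of 8-variable MM# cubics with CUBIC dual, 0 left MM#
(REVIEW3 families (3)–(4), REVIEW4 walks), while 1.36 % of the quartic-dual ones do; all Carlet-move successors
with cubic duals stay MM# (2350 + 313 + 4500 moves, r1-2 M5 / REVIEW4). The cubic dual must be consumed: PPKZ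
arXiv:2310.10162 Ex. 4 (cubic, bent, pieces MM#, `∉` MM#, dual QUARTIC) and Disproof `_false_without_fCubic`
(`h^10_4`) are exactly the failures without it. Why it might fail: four MM# pieces with pairwise non-alignable
Dillon subspaces glued by a cubic dual (Gold-type pieces with a unique Dillon subspace, r1-1 F4; r1-2 M1: pieces
have MANY Dillon subspaces, so the gluing must CHOOSE — `Align`/`CommonDirection` of `bent4-descent-gluing`).
At `m = 4` (`n = 10`) this stub is the entire first open case of the crux (triage r1-1/r1-3). Size: L–XL. -/
theorem stub_pencilAscent : ∀ (m : ℕ), 4 ≤ m → ∀ f g : (Fin ((m + 1) + (m + 1)) → Bool) → Bool,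
    (∃ p : MvPolynomial (Fin ((m + 1) + (m + 1))) (ZMod 2), p.totalDegree ≤ 3 ∧
      ∀ x, f x = decide (MvPolynomial.eval (fun j => if x j then (1 : ZMod 2) else 0) p = 1)) →
    (∃ p : MvPolynomial (Fin ((m + 1) + (m + 1))) (ZMod 2), p.totalDegree ≤ 3 ∧
      ∀ x, g x = decide (MvPolynomial.eval (fun j => if x j then (1 : ZMod 2) else 0) p = 1)) →
    (∀ x : Fin ((m + 1) + (m + 1)) → Bool,
      DerivativeWalsh.W (fun y => signOf (g y)) x = 2 ^ (m + 1) * signOf (f x)) →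
    ∀ a b : Fin ((m + 1) + (m + 1)) → Bool,
    (∀ x, (f x ^^ f (bx x a) ^^ f (bx x b) ^^ f (bx (bx x a) b)) = true) →
    (∃ p : MvPolynomial (Fin ((m + 1) + (m + 1))) (ZMod 2), p.totalDegree ≤ 3 ∧
      ∀ x, ((f x ^^ f (bx x a)) && (f x ^^ f (bx x b))) =
        decide (MvPolynomial.eval (fun j => if x j then (1 : ZMod 2) else 0) p = 1)) →
    ∀ L : (Fin (m + m) → Bool) → (Fin ((m + 1) + (m + 1)) → Bool),
    (∃ M : Matrix (Fin ((m + 1) + (m + 1))) (Fin (m + m)) (ZMod 2),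
      ∀ y i, (if L y i then (1 : ZMod 2) else 0) = M.mulVec (fun j => if y j then (1 : ZMod 2) else 0) i) →
    Function.Injective L →
    (∀ y, (∑ i, (if a i then (1 : ZMod 2) else 0) * (if L y i then (1 : ZMod 2) else 0)) = 0 ∧
      (∑ i, (if b i then (1 : ZMod 2) else 0) * (if L y i then (1 : ZMod 2) else 0)) = 0) →
    (∀ x₀ : Fin ((m + 1) + (m + 1)) → Bool,
      (∃ f' : (Fin (m + m) → Bool) → Bool,
        (∃ p : MvPolynomial (Fin (m + m)) (ZMod 2), p.totalDegree ≤ 3 ∧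
          ∀ y, f' y = decide (MvPolynomial.eval (fun j => if y j then (1 : ZMod 2) else 0) p = 1)) ∧
        ∀ u : Fin (m + m) → Bool,
          DerivativeWalsh.W (fun y => signOf (g (bx x₀ (L y)))) u = 2 ^ m * signOf (f' u)) ∧
      MMConclusionAt m (fun y => g (bx x₀ (L y)))) →
    MMConclusionAt (m + 1) g := by
  sorry

/-! ## Small proved helper for the composition -/

/-- A dual pair is in particular bent: `W_g(x) = 2^m (−1)^{f x}` gives `W_g(x) = ±2^m`. -/
theorem bent_of_dualPair {k m : ℕ} {f g : (Fin k → Bool) → Bool}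
    (h : ∀ x, DerivativeWalsh.W (fun y => signOf (g y)) x = 2 ^ m * signOf (f x)) (x : Fin k → Bool) :
    DerivativeWalsh.W (fun y => signOf (g y)) x = 2 ^ m ∨
      DerivativeWalsh.W (fun y => signOf (g y)) x = -(2 ^ m) := by
  have hx := h x
  cases hfx : f x
  · left
    rw [hx, hfx]
    simp [signOf]
  · right
    rw [hx, hfx]
    simp [signOf]

/-! ## The composition: the five stubs give the crux BY NAME (induction on `m`) -/

/-- `ExactPairsMaioranaMcFarland` from S1–S5: strong enough plain induction on the half-dimension `m`.
Base `m ≤ 4`: S1 turns `forrelation f g = 1` into the Walsh identity, hence bentness, and S2 concludes.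
Step `m + 1 ≥ 5`: S1 (Walsh identity) → S3 (a good pencil `(a,b)` of the cubic dual `f`) → for each coset, S4 gives
an affine chart `φ` with `g ∘ φ` cubic, bent, CUBIC dual `f'`; S1 backwards makes `(f', g ∘ φ)` an exactly
forrelated cubic pair in dimension `m`, so the induction hypothesis puts `g ∘ φ` in MM#; S5 glues. -/
theorem ExactPairsMaioranaMcFarland_of :
    Summit.QuantumAdvantage.QuantumAdvantage.Theses.CubicForrelation.ExactPairsMaioranaMcFarland := by
  refine exactPairsMaioranaMcFarland_iff.2 ?_
  intro m
  induction m with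
  | zero =>
    intro f g hf hg hΦ
    exact stub_smallCases 0 (by norm_num) g hg (bent_of_dualPair ((stub_dualPair 0 f g).1 hΦ))
  | succ m ih =>
    intro f g hf hg hΦ
    have hd := (stub_dualPair (m + 1) f g).1 hΦ
    rcases Nat.lt_or_ge m 4 with hm | hm
    · exact stub_smallCases (m + 1) (by omega) g hg (bent_of_dualPair hd)
    · obtain ⟨a, b, hab, hgood⟩ := stub_goodPencil m hm f g hf hg hd
      obtain ⟨L, hLlin, hLinj, hLV, hpieces⟩ := stub_pencilDecomposition m f g hf hg hd a b hab hgood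
      refine stub_pencilAscent m hm f g hf hg hd a b hab hgood L hLlin hLinj hLV ?_
      intro x₀
      obtain ⟨hgL, f', hf', hd'⟩ := hpieces x₀
      exact ⟨⟨f', hf', hd'⟩, ih f' (fun y => g (bx x₀ (L y))) hf' hgL ((stub_dualPair m f' _).2 hd')⟩

end Summit.QuantumAdvantage.QuantumAdvantage.Cruxes.ExactPairsMaioranaMcFarland.BentPencilDescent
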